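import Summits.Ventures.PercRepro.RankLevelSetLevelSixHeavyCellSq27D
import Summits.Ventures.PercRepro.TriangleCapEightI
import Summits.Ventures.PercRepro.RankLevelSetFourCircuitNullityFour
import Summits.Ventures.PercRepro.S1FiveCircuitBase
import Summits.Ventures.PercRepro.RankLevelSetLevelSixArithHeavySq25SA
import Summits.Ventures.PercRepro.RankLevelSetLevelSixArithHeavySq25SB
import Summits.Ventures.PercRepro.RankLevelSetLevelSixArithHeavySq25SC
import Summits.Ventures.PercRepro.RankLevelSetLevelSixArithHeavySq25SD

/-!
# PercRepro — THE 26 ROW, THE COLOOP CASE: THE SCALED CELLS `(p ≥ 25, 7 ≤ d ≤ 14)` (p8 g7, S3)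

`proofs/SUBCLAIM-S3-p8.md` §3u (THE 26 ROW, on the nullity-4 cap 16). The SCALED cells `(Φ(p+1, 6)/2)·#U(p, 6) ≤ #Y(p, 6)` on every `e`-free core of rank `p ≥ 26` and corank `7 ≤ d ≤ 14`, by the D-cell `c025_core_six_heavy_cell_sq27d` (RankLevelSetLevelSixHeavyCellSq27D) with `D = C(p + 7, 6)`, `Φ = Φ(p + 1, 6)/2 ≤ 2^{p+6}/D` (`phiK_succ_div_two_le`) and p2's nullity-only chains (`avgChain 7 … 14 = 79 … 611`, `avgChain5b 7 … 14 = 401 … 5877`); ratios `0.88 / 0.91 / 0.89 / 0.91 / 0.75 / 0.75 / 0.58 / 0.57` (the honest `(26, d)` ratio times `C(32, 6)/C(33, 6)`); the arithmetic of RankLevelSetLevelSixArithHeavySq25SA … D. Through `RLS_of_coloop_scaled` this is the coloop case of the `26` row at `d ≤ 14`. Axioms: standard.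
-/

open scoped Matroid

namespace PercRepro

namespace ThmN

open Set

variable {α : Type}

/-- **The SCALED cell on every `e`-free core of rank `p ≥ 25`, corank `7 ≤ d ≤ 14`**: `(Φ(p+1, 6)/2)·#U(p, 6) ≤ #Y(p, 6)` (the D-cell `c025_core_six_heavy_cell_sq27d` with `D = C(p + 7, 6)`, the per-corank parameters of ArithHeavySq25SA … D and p2's nullity-only chains `avgChain` / `avgChain5b`) — the coloop case of the `26` row. -/
theorem c025_core_six_scaled_heavy_sq25s (M : Matroid α) [M.Finite] (p d : ℕ) (hp : 25 ≤ p) (hd7 : 7 ≤ d) (hd14 : d ≤ 14)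
    (hR : M.eRank = (p : ℕ∞)) (hn : M.E.ncard = p + d)
    (hfree : ∀ e ∈ M.E, ∃ A ⊆ M.E \ {e}, e ∉ M.closure A ∧ e ∉ M.closure ((M.E \ {e}) \ A)) :
    phiK (p + 1) 6 / 2 * (Matroid.topCount M p 6 : ℚ) ≤ (Matroid.midCount M p 6 : ℚ) := by
  have hd : M.E.encard = M.eRank + d := by
    rw [hR, ← M.ground_finite.cast_ncard_eq, hn]
    push_cast
    ring
  have hL : ∀ e ∈ M.E, ¬ M.IsLoop e := not_isLoop_of_free M hfree
  have hs : ∀ e ∈ M.E, ∀ f ∈ M.E, e ≠ f → M.eRk {e, f} = 2 := by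
    intro e he f hf hef
    have h2 : (2 : ℕ∞) ≤ M.eRk {e, f} :=
      two_le_eRk_of_two_le_ncard_of_free M hfree (pair_subset he hf) (by rw [ncard_pair hef])
    have h3 : M.eRk {e, f} ≤ 2 := by
      have := M.eRk_le_encard {e, f}
      rwa [encard_pair hef] at this
    exact le_antisymm h3 h2
  have hC1 : ∀ L ⊆ M.E, M.eRk L = 2 → L.ncard ≤ 3 :=
    fun L hL hr => ncard_le_three_of_eRk_two M hs hfree hL hr
  have hC2 : ∀ P ⊆ M.E, M.eRk P ≤ 3 → P.ncard ≤ 6 :=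
    fun P hP hr => ncard_le_six_of_eRk_le_three_of_free M hfree hP hr
  have hΦ : phiK (p + 1) 6 / 2 ≤ (2 : ℚ) ^ (p + 6) / (((p + 7).choose 6 : ℕ) : ℚ) := by
    have := phiK_succ_div_two_le p 6
    rwa [show p + 1 + 6 = p + 7 by omega] at this
  interval_cases d
  · exact c025_core_six_heavy_cell_sq27d M p 7 7 1 1 13 12 0 278926 1000 13 401 69 11
      ((p + 7).choose 6) (Nat.choose_pos (by omega)) (phiK (p + 1) 6 / 2) hΦ
      (by norm_num) (by norm_num) (by norm_num) (by norm_num) (by norm_num) (by norm_num)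
      (by norm_num [cnull]) (by norm_num [cnull]) (Or.inl (by norm_num)) (Or.inl (by norm_num)) (Or.inl (by norm_num)) (by norm_num) (by norm_num) (by norm_num)
      ((TriangleCap.core_ncard_triangles_le_cq3 M hfree hd).trans (by decide))
      ((ncard_fourCircuits_le_avgChain16 7 M hfree hd).trans (by decide))
      ((S1.ncard_fiveCircuits_le_avgChain5b 7 M hfree hd).trans (by decide))
      (Or.inl (tail_six_heavy_sq25S_7 p hp)) hR hn hfree (level_six_poly_heavy_sq25S_7 p hp)
  · exact c025_core_six_heavy_cell_sq27d M p 8 7 2 1 16 14 0 226312 1000 14 651 99 13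
      ((p + 7).choose 6) (Nat.choose_pos (by omega)) (phiK (p + 1) 6 / 2) hΦ
      (by norm_num) (by norm_num) (by norm_num) (by norm_num) (by norm_num) (by norm_num)
      (by norm_num [cnull]) (by norm_num [cnull]) (Or.inl (by norm_num)) (Or.inl (by norm_num)) (Or.inl (by norm_num)) (by norm_num) (by norm_num) (by norm_num)
      ((TriangleCap.core_ncard_triangles_le_cq3 M hfree hd).trans (by decide))
      ((ncard_fourCircuits_le_avgChain16 8 M hfree hd).trans (by decide))
      ((S1.ncard_fiveCircuits_le_avgChain5b 8 M hfree hd).trans (by decide))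
      (Or.inl (tail_six_heavy_sq25S_8 p hp)) hR hn hfree (level_six_poly_heavy_sq25S_8 p hp)
  · exact c025_core_six_heavy_cell_sq27d M p 9 7 2 1 19 16 0 158481 1000 15 1012 138 16
      ((p + 7).choose 6) (Nat.choose_pos (by omega)) (phiK (p + 1) 6 / 2) hΦ
      (by norm_num) (by norm_num) (by norm_num) (by norm_num) (by norm_num) (by norm_num)
      (by norm_num [cnull]) (by norm_num [cnull]) (Or.inl (by norm_num)) (Or.inl (by norm_num)) (Or.inl (by norm_num)) (by norm_num) (by norm_num) (by norm_num)
      ((TriangleCap.core_ncard_triangles_le_cq3 M hfree hd).trans (by decide))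
      ((ncard_fourCircuits_le_avgChain16 9 M hfree hd).trans (by decide))
      ((S1.ncard_fiveCircuits_le_avgChain5b 9 M hfree hd).trans (by decide))
      (Or.inl (tail_six_heavy_sq25S_9 p hp)) hR hn hfree (level_six_poly_heavy_sq25S_9 p hp)
  · exact c025_core_six_heavy_cell_sq27d M p 10 9 1 1 17 15 0 102322 1000 16 1518 188 20
      ((p + 7).choose 6) (Nat.choose_pos (by omega)) (phiK (p + 1) 6 / 2) hΦ
      (by norm_num) (by norm_num) (by norm_num) (by norm_num) (by norm_num) (by norm_num)
      (by norm_num [cnull]) (by norm_num [cnull]) (Or.inl (by norm_num)) (Or.inr (Or.inl ⟨by norm_num, by norm_num⟩)) (Or.inl (by norm_num)) (by norm_num) (by norm_num) (by norm_num)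
      ((TriangleCap.core_ncard_triangles_le_cq3 M hfree hd).trans (by decide))
      ((ncard_fourCircuits_le_avgChain16 10 M hfree hd).trans (by decide))
      ((S1.ncard_fiveCircuits_le_avgChain5b 10 M hfree hd).trans (by decide))
      (Or.inl (tail_six_heavy_sq25S_10 p hp)) hR hn hfree (level_six_poly_heavy_sq25S_10 p hp)
  · exact c025_core_six_heavy_cell_sq27d M p 11 9 1 1 19 16 0 64711 1000 17 2208 250 24
      ((p + 7).choose 6) (Nat.choose_pos (by omega)) (phiK (p + 1) 6 / 2) hΦ
      (by norm_num) (by norm_num) (by norm_num) (by norm_num) (by norm_num) (by norm_num)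
      (by norm_num [cnull]) (by norm_num [cnull]) (Or.inl (by norm_num)) (Or.inr (Or.inl ⟨by norm_num, by norm_num⟩)) (Or.inl (by norm_num)) (by norm_num) (by norm_num) (by norm_num)
      ((TriangleCap.core_ncard_triangles_le_cq3 M hfree hd).trans (by decide))
      ((ncard_fourCircuits_le_avgChain16 11 M hfree hd).trans (by decide))
      ((S1.ncard_fiveCircuits_le_avgChain5b 11 M hfree hd).trans (by decide))
      (Or.inl (tail_six_heavy_sq25S_11 p hp)) hR hn hfree (level_six_poly_heavy_sq25S_11 p hp)
  · exact c025_core_six_heavy_cell_sq27d M p 12 10 1 1 20 17 0 41068 1000 18 3128 326 29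
      ((p + 7).choose 6) (Nat.choose_pos (by omega)) (phiK (p + 1) 6 / 2) hΦ
      (by norm_num) (by norm_num) (by norm_num) (by norm_num) (by norm_num) (by norm_num)
      (by norm_num [cnull]) (by norm_num [cnull]) (Or.inl (by norm_num)) (Or.inr (Or.inl ⟨by norm_num, by norm_num⟩)) (Or.inl (by norm_num)) (by norm_num) (by norm_num) (by norm_num)
      ((TriangleCap.core_ncard_triangles_le_cq3 M hfree hd).trans (by decide))
      ((ncard_fourCircuits_le_avgChain16 12 M hfree hd).trans (by decide))
      ((S1.ncard_fiveCircuits_le_avgChain5b 12 M hfree hd).trans (by decide))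
      (Or.inl (tail_six_heavy_sq25S_12 p hp)) hR hn hfree (level_six_poly_heavy_sq25S_12 p hp)
  · exact c025_core_six_heavy_cell_sq27d M p 13 10 1 1 22 18 0 26973 1000 19 4331 419 34
      ((p + 7).choose 6) (Nat.choose_pos (by omega)) (phiK (p + 1) 6 / 2) hΦ
      (by norm_num) (by norm_num) (by norm_num) (by norm_num) (by norm_num) (by norm_num)
      (by norm_num [cnull]) (by norm_num [cnull]) (Or.inl (by norm_num)) (Or.inr (Or.inl ⟨by norm_num, by norm_num⟩)) (Or.inl (by norm_num)) (by norm_num) (by norm_num) (by norm_num)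
      ((TriangleCap.core_ncard_triangles_le_cq3 M hfree hd).trans (by decide))
      ((ncard_fourCircuits_le_avgChain16 13 M hfree hd).trans (by decide))
      ((S1.ncard_fiveCircuits_le_avgChain5b 13 M hfree hd).trans (by decide))
      (Or.inl (tail_six_heavy_sq25S_13 p hp)) hR hn hfree (level_six_poly_heavy_sq25S_13 p hp)
  · exact c025_core_six_heavy_cell_sq27d M p 14 11 1 1 23 19 0 18330 1000 20 5877 530 40
      ((p + 7).choose 6) (Nat.choose_pos (by omega)) (phiK (p + 1) 6 / 2) hΦ
      (by norm_num) (by norm_num) (by norm_num) (by norm_num) (by norm_num) (by norm_num)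
      (by norm_num [cnull]) (by norm_num [cnull]) (Or.inl (by norm_num)) (Or.inr (Or.inl ⟨by norm_num, by norm_num⟩)) (Or.inl (by norm_num)) (by norm_num) (by norm_num) (by norm_num)
      ((TriangleCap.core_ncard_triangles_le_cq3 M hfree hd).trans (by decide))
      ((ncard_fourCircuits_le_avgChain16 14 M hfree hd).trans (by decide))
      ((S1.ncard_fiveCircuits_le_avgChain5b 14 M hfree hd).trans (by decide))
      (Or.inl (tail_six_heavy_sq25S_14 p hp)) hR hn hfree (level_six_poly_heavy_sq25S_14 p hp)
end ThmN

end PercRepro
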